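import Mathlib
import Summits.QuantumFields.YangMills.Theorems.TransportFieldFanoVacuumConcentrationRpowArith
import HarnessLib

/-!
# Three-layer onion arithmetic at radius `β^{−p}`: per-layer ratios and the `θ·N` bookkeeping
# (route `TransportFieldFano`, LINE g17-A, crux ⟨stmt-QuantumFields-23353⟩ helper lane; companion of `…VacuumConcentrationOfGain`,
# sequel to ✓`…VacuumConcentrationRpowArith`)

* §1 `three_layer_arith_gen` — three onion layers with target `θ·N` (per-layer ratios `a e_i ≤ q ≤ 1`, `q³ ≤ θ/2`, tiny terms `≤ θ/18`);
* §2 `endgame_real_layers` — at radius `ρ = β^{−p}` (any `p` with `2/3 − 2p > 0`): with `A = (K₀/c_L)·β^{−(2/3−2p)}`, `K₀ = 6n²(8π)²/f`,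
  the ratios `a·e(ρ), a·e(3ρ), a·e(9ρ) ≤ A ≤ 1` and the three tiny terms `≤ 1/(16β)` (same scale relations as ✓`endgame_real_rpow`, without
  its `p < 5/24` product condition).
HONEST FRAMING: pure real arithmetic for a fixed-lattice helper; nothing about infinite volume, the continuum or the Yang–Mills mass gap; no summit
statement.  No `sorry`, no new definition, no named-fact hypothesis.
References: [cite: SimonB1983DiscreteSpectrum, §3]; [cite: Luscher1983, §2–3].
-/

set_option autoImplicit false

noncomputable section

open Real

namespace Summit.QuantumFields.YangMills.Theorems.TransportFieldFano

namespace VacuumConc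

/-! ## §1 Three layers with a general target `θ·N` -/

/-- Pure arithmetic of the three-layer onion with target `θ·N`: per-layer ratios `a e_i ≤ q ≤ 1`, `q³ ≤ θ/2`, tiny terms `≤ θ/18`. [folklore] -/
theorem three_layer_arith_gen {N X₁ X₂ X₃ a cb e₁ e₂ e₃ k t q θ : ℝ} (hN : 0 ≤ N)
    (ha : 0 ≤ a) (hcb : 0 ≤ cb) (hk : 0 ≤ k) (ht : 0 ≤ t) (hq : 0 ≤ q)
    (hX1nn : 0 ≤ X₁) (hX2nn : 0 ≤ X₂)
    (hX1 : X₁ ≤ a * (cb * N + e₁ * N + k * N) + t * N)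
    (hX2 : X₂ ≤ a * (cb * N + e₂ * X₁ + k * N) + t * N)
    (hX3 : X₃ ≤ a * (cb * N + e₃ * X₂ + k * N) + t * N)
    (hq1 : a * e₁ ≤ q) (hq2 : a * e₂ ≤ q) (hq3 : a * e₃ ≤ q) (hq1' : q ≤ 1) (hmain : q ^ 3 ≤ θ / 2)
    (hcb' : a * cb ≤ θ / 18) (hk' : a * k ≤ θ / 18) (ht' : t ≤ θ / 18) :
    X₃ ≤ θ * N := by
  set τ : ℝ := a * cb + a * k + t with hτ
  have hτθ : τ ≤ θ / 6 := by rw [hτ]; linarith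
  have hτ0 : 0 ≤ τ := by rw [hτ]; positivity
  have h1 : X₁ ≤ q * N + τ * N := by
    have e : a * (cb * N + e₁ * N + k * N) + t * N = (a * e₁) * N + τ * N := by rw [hτ]; ring
    rw [e] at hX1
    nlinarith [mul_le_mul_of_nonneg_right hq1 hN]
  have h2 : X₂ ≤ τ * N + q * X₁ := by
    have e : a * (cb * N + e₂ * X₁ + k * N) + t * N = (a * e₂) * X₁ + τ * N := by rw [hτ]; ring
    rw [e] at hX2
    nlinarith [mul_le_mul_of_nonneg_right hq2 hX1nn]
  have h3 : X₃ ≤ τ * N + q * X₂ := by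
    have e : a * (cb * N + e₃ * X₂ + k * N) + t * N = (a * e₃) * X₂ + τ * N := by rw [hτ]; ring
    rw [e] at hX3
    nlinarith [mul_le_mul_of_nonneg_right hq3 hX2nn]
  have h2' : X₂ ≤ 2 * τ * N + q ^ 2 * N := by
    have hqX : q * X₁ ≤ q * (q * N + τ * N) := mul_le_mul_of_nonneg_left h1 hq
    have hqτ : q * (τ * N) ≤ 1 * (τ * N) := mul_le_mul_of_nonneg_right hq1' (by positivity)
    nlinarith
  have h3' : X₃ ≤ 3 * τ * N + q ^ 3 * N := by
    have hqX : q * X₂ ≤ q * (2 * τ * N + q ^ 2 * N) := mul_le_mul_of_nonneg_left h2' hq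
    have hqτ : q * (2 * τ * N) ≤ 1 * (2 * τ * N) := mul_le_mul_of_nonneg_right hq1' (by positivity)
    nlinarith
  have h4 : 3 * τ * N + q ^ 3 * N ≤ θ * N := by
    have := mul_le_mul_of_nonneg_right hmain hN
    have := mul_le_mul_of_nonneg_right hτθ hN
    nlinarith
  linarith

/-! ## §2 The per-layer ratios at radius `ρ = β^{−p}` -/

set_option maxHeartbeats 800000 in
/-- The per-layer ratios and the tiny terms of the onion at radius `ρ = β^{−p}` (no restriction on `p` beyond the eventual inequalities):
with `A := (K₀/c_L)·β^{−(2/3 − 2p)}`, `K₀ = 6n²(8π)²/f`: `a·e(ρ) ≤ A`, `a·e(3ρ) ≤ A`, `a·e(9ρ) ≤ A`, `A ≤ 1`, `0 ≤ A`, and `a·cb, a·k, t ≤ 1/(16β)`.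
[folklore] -/
theorem endgame_real_layers (n : ℕ) {β f w lat lam u cL ρ η γ L3 cb p : ℝ}
    (hβ1 : 1 ≤ β) (hn : 0 < (n : ℝ)) (hf : 0 < f) (hw : 0 < w) (hlat : 0 < lat) (hlamf : f * lat ≤ lam)
    (hu0 : 0 < u) (hcL : 0 < cL) (hu : u = cL * β ^ (-(1 : ℝ) / 3)) (hL3 : 0 < L3) (hinvu : 1 / u ≤ L3 * β)
    (hρ : ρ = β ^ (-p)) (hη : η = β ^ (-(17 / 20 : ℝ))) (hγu : u / 2 ≤ γ)
    (hcb0 : 0 ≤ cb) (hcb : cb ≤ (4 / w) ^ n * β ^ (2 * n) * Real.exp (-(1 / (8 * n) * β ^ (1 - 2 * p))) * lat)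
    (h2 : (6 * (n : ℝ) ^ 2 * (8 * π) ^ 2 / f) / cL + 4 ≤ β ^ (2 / 3 - 2 * p) / 2)
    (h3 : 16 * (4 * L3 / f) * (4 / w) ^ n * β ^ (2 * n + 2) * Real.exp (-(1 / (8 * n) * β ^ (1 - 2 * p))) ≤ 1)
    (h4 : 16 * (4 * L3 / f) * (1 + 4 * L3) * β ^ 3 * Real.exp (-(β ^ ((3 : ℝ) / 20))) ≤ 1)
    (h5 : 16 / f * β * Real.exp (-(β ^ ((3 : ℝ) / 20))) ≤ 1) :
    2 / (γ * lam) * ((1 / 2) * ((n : ℝ) ^ 2 * (8 * π / ρ) ^ 2 * (3 / β) * lat)) ≤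
        (6 * (n : ℝ) ^ 2 * (8 * π) ^ 2 / f) / cL * β ^ (-(2 / 3 - 2 * p)) ∧
      2 / (γ * lam) * ((1 / 2) * ((n : ℝ) ^ 2 * (8 * π / (3 * ρ)) ^ 2 * (3 / β) * lat)) ≤
        (6 * (n : ℝ) ^ 2 * (8 * π) ^ 2 / f) / cL * β ^ (-(2 / 3 - 2 * p)) ∧
      2 / (γ * lam) * ((1 / 2) * ((n : ℝ) ^ 2 * (8 * π / (9 * ρ)) ^ 2 * (3 / β) * lat)) ≤
        (6 * (n : ℝ) ^ 2 * (8 * π) ^ 2 / f) / cL * β ^ (-(2 / 3 - 2 * p)) ∧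
      (6 * (n : ℝ) ^ 2 * (8 * π) ^ 2 / f) / cL * β ^ (-(2 / 3 - 2 * p)) ≤ 1 ∧
      0 ≤ (6 * (n : ℝ) ^ 2 * (8 * π) ^ 2 / f) / cL * β ^ (-(2 / 3 - 2 * p)) ∧
      2 / (γ * lam) * cb ≤ 1 / (16 * β) ∧
      2 / (γ * lam) * ((1 + 2 / γ) * (Real.exp (-(β * η)) * lat)) ≤ 1 / (16 * β) ∧
      Real.exp (-(β * η)) * lat / lam ≤ 1 / (16 * β) := by
  have hβ0 : 0 < β := by linarith
  have hββ : ∀ x : ℝ, β * β ^ x = β ^ (1 + x) := fun x => by rw [Real.rpow_add hβ0, Real.rpow_one]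
  have hρ0 : 0 < ρ := by rw [hρ]; exact Real.rpow_pos_of_pos hβ0 _
  have h3ρ0 : 0 < 3 * ρ := by positivity
  have h9ρ0 : 0 < 9 * ρ := by positivity
  have hγ0 : 0 < γ := by linarith
  have hlam0 : 0 < lam := lt_of_lt_of_le (by positivity) hlamf
  set K₀ : ℝ := 6 * (n : ℝ) ^ 2 * (8 * π) ^ 2 / f with hK₀
  have hK₀0 : 0 < K₀ := by positivity
  set a : ℝ := 2 / (γ * lam) with hadef
  have ha0 : 0 ≤ a := by positivity
  set e₁ : ℝ := (1 / 2) * ((n : ℝ) ^ 2 * (8 * π / ρ) ^ 2 * (3 / β) * lat) with he₁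
  set e₂ : ℝ := (1 / 2) * ((n : ℝ) ^ 2 * (8 * π / (3 * ρ)) ^ 2 * (3 / β) * lat) with he₂
  set e₃ : ℝ := (1 / 2) * ((n : ℝ) ^ 2 * (8 * π / (9 * ρ)) ^ 2 * (3 / β) * lat) with he₃
  have he₂1 : e₂ ≤ e₁ := by
    rw [he₁, he₂]
    have h1 : 8 * π / (3 * ρ) ≤ 8 * π / ρ := div_le_div_of_nonneg_left (by positivity) hρ0 (by linarith)
    gcongr
  have he₃1 : e₃ ≤ e₁ := by
    rw [he₁, he₃]
    have h1 : 8 * π / (9 * ρ) ≤ 8 * π / ρ := div_le_div_of_nonneg_left (by positivity) hρ0 (by linarith)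
    gcongr
  -- `a ≤ 4/(u f lat)`
  have ha_le : a ≤ 4 / (u * (f * lat)) := by
    rw [hadef, div_le_div_iff₀ (by positivity) (by positivity)]
    have : u * (f * lat) ≤ (2 * γ) * lam := mul_le_mul (by linarith only [hγu]) hlamf (by positivity) (by positivity)
    linarith only [this]
  set s : ℝ := 2 / 3 - 2 * p with hs
  have hM : u * ρ ^ 2 * β = cL * β ^ s := by
    have hex : s = -(1 : ℝ) / 3 + (-p * ((2 : ℕ) : ℝ)) + 1 := by rw [hs]; push_cast; ring
    rw [hu, hρ, ← Real.rpow_mul_natCast hβ0.le, hex, Real.rpow_add hβ0, Real.rpow_add hβ0, Real.rpow_one]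
    ring
  have hM0 : 0 < u * ρ ^ 2 * β := by positivity
  have hβs0 : 0 < β ^ s := Real.rpow_pos_of_pos hβ0 _
  -- `A = K₀/(uρ²β) = (K₀/cL)·β^{−s}`
  have hAeq : K₀ / (u * ρ ^ 2 * β) = K₀ / cL * β ^ (-s) := by
    rw [hM, Real.rpow_neg hβ0.le]
    field_simp
  have hae : a * e₁ ≤ K₀ / (u * ρ ^ 2 * β) := by
    calc a * e₁ ≤ 4 / (u * (f * lat)) * e₁ := mul_le_mul_of_nonneg_right ha_le (by positivity)
      _ = K₀ / (u * ρ ^ 2 * β) := by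
          rw [he₁, hK₀]
          field_simp
          ring
  have hq1 : a * e₁ ≤ K₀ / cL * β ^ (-s) := by rw [← hAeq]; exact hae
  have hq2 : a * e₂ ≤ K₀ / cL * β ^ (-s) := (mul_le_mul_of_nonneg_left he₂1 ha0).trans hq1
  have hq3 : a * e₃ ≤ K₀ / cL * β ^ (-s) := (mul_le_mul_of_nonneg_left he₃1 ha0).trans hq1
  have hA0 : 0 ≤ K₀ / cL * β ^ (-s) := by positivity
  have hA1 : K₀ / cL * β ^ (-s) ≤ 1 := by
    rw [← hAeq, hM, div_le_one (by positivity)]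
    have h' := (le_div_iff₀ (by norm_num : (0 : ℝ) < 2)).1 h2
    have hKc : 0 ≤ K₀ / cL := by positivity
    have hβa : K₀ / cL ≤ β ^ s := by rw [hs]; exact le_trans (by linarith) h'
    rw [div_le_iff₀ hcL] at hβa
    linarith [hβa]
  -- the super-polynomially small terms (verbatim from `endgame_real_rpow`)
  have hexp2 : β * η = β ^ ((3 : ℝ) / 20) := by rw [hη, hββ]; norm_num
  have hcb' : a * cb ≤ 1 / (16 * β) := by
    set X : ℝ := (4 / w) ^ n * β ^ (2 * n) * Real.exp (-(1 / (8 * n) * β ^ (1 - 2 * p))) with hX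
    have hX0 : 0 ≤ X := by positivity
    have h1 : a * cb ≤ 4 / (u * (f * lat)) * (X * lat) := mul_le_mul ha_le hcb hcb0 (by positivity)
    have h2 : 4 / (u * (f * lat)) * (X * lat) = (4 * (1 / u) / f) * X := by field_simp
    rw [h2] at h1
    have h3' : 4 * (1 / u) / f ≤ 4 * (L3 * β) / f := div_le_div_of_nonneg_right (by linarith only [hinvu]) hf.le
    have h4' : a * cb ≤ 4 * (L3 * β) / f * X := h1.trans (mul_le_mul_of_nonneg_right h3' hX0)
    rw [le_div_iff₀ (by positivity)]
    have h5' : a * cb * (16 * β) ≤ 4 * (L3 * β) / f * X * (16 * β) := mul_le_mul_of_nonneg_right h4' (by positivity)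
    have e : 16 * (4 * L3 / f) * (4 / w) ^ n * β ^ (2 * n + 2) * Real.exp (-(1 / (8 * n) * β ^ (1 - 2 * p)))
        = 4 * (L3 * β) / f * X * (16 * β) := by
      rw [hX, pow_add]; ring
    rw [e] at h3
    exact h5'.trans h3
  have hk' : a * ((1 + 2 / γ) * (Real.exp (-(β * η)) * lat)) ≤ 1 / (16 * β) := by
    have hγ' : 2 / γ ≤ 4 * (1 / u) := by
      rw [div_le_iff₀ hγ0]
      have e : 4 * (1 / u) * γ = 4 * γ / u := by ring
      rw [e, le_div_iff₀ hu0]; linarith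
    have hE0 : 0 < Real.exp (-(β * η)) := Real.exp_pos _
    have h1 : (1 + 2 / γ) * (Real.exp (-(β * η)) * lat) ≤ (1 + 4 * (1 / u)) * (Real.exp (-(β * η)) * lat) :=
      mul_le_mul_of_nonneg_right (by linarith only [hγ']) (by positivity)
    have h2 : a * ((1 + 2 / γ) * (Real.exp (-(β * η)) * lat)) ≤ 4 / (u * (f * lat)) * ((1 + 4 * (1 / u)) * (Real.exp (-(β * η)) * lat)) :=
      mul_le_mul ha_le h1 (by positivity) (by positivity)
    have h3' : 4 / (u * (f * lat)) * ((1 + 4 * (1 / u)) * (Real.exp (-(β * η)) * lat))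
        = 4 * (1 / u) / f * (1 + 4 * (1 / u)) * Real.exp (-(β * η)) := by field_simp
    rw [h3'] at h2
    have h4' : 4 * (1 / u) / f * (1 + 4 * (1 / u)) ≤ 4 * (L3 * β) / f * (1 + 4 * (L3 * β)) :=
      mul_le_mul (div_le_div_of_nonneg_right (by linarith only [hinvu]) hf.le) (by linarith only [hinvu]) (by positivity)
        (by positivity)
    have h5' : 4 * (L3 * β) / f * (1 + 4 * (L3 * β)) ≤ (4 * L3 / f) * (1 + 4 * L3) * β ^ 2 := by
      have hb : 1 + 4 * (L3 * β) ≤ (1 + 4 * L3) * β := by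
        have e' : (1 + 4 * L3) * β = β + 4 * (L3 * β) := by ring
        rw [e']; linarith only [hβ1]
      have e : 4 * (L3 * β) / f * ((1 + 4 * L3) * β) = (4 * L3 / f) * (1 + 4 * L3) * β ^ 2 := by ring
      rw [← e]; exact mul_le_mul_of_nonneg_left hb (by positivity)
    have h6 : a * ((1 + 2 / γ) * (Real.exp (-(β * η)) * lat)) ≤ (4 * L3 / f) * (1 + 4 * L3) * β ^ 2 * Real.exp (-(β * η)) :=
      h2.trans (mul_le_mul_of_nonneg_right (h4'.trans h5') hE0.le)
    have h4'' : 16 * (4 * L3 / f) * (1 + 4 * L3) * β ^ 3 * Real.exp (-(β * η)) ≤ 1 := by rw [hexp2]; exact h4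
    rw [le_div_iff₀ (by positivity)]
    have h7 := mul_le_mul_of_nonneg_right h6 (show (0 : ℝ) ≤ 16 * β by positivity)
    have e : (4 * L3 / f) * (1 + 4 * L3) * β ^ 2 * Real.exp (-(β * η)) * (16 * β)
        = 16 * (4 * L3 / f) * (1 + 4 * L3) * β ^ 3 * Real.exp (-(β * η)) := by ring
    generalize Real.exp (-(β * η)) = X at h7 e h4'' ⊢
    linarith [h7, e, h4'']
  have ht' : Real.exp (-(β * η)) * lat / lam ≤ 1 / (16 * β) := by
    have h1 : Real.exp (-(β * η)) * lat / lam ≤ Real.exp (-(β * η)) * lat / (f * lat) :=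
      div_le_div_of_nonneg_left (by positivity) (by positivity) hlamf
    have h2 : Real.exp (-(β * η)) * lat / (f * lat) = Real.exp (-(β ^ ((3 : ℝ) / 20))) / f := by
      rw [hexp2]; field_simp
    rw [h2] at h1
    rw [le_div_iff₀ (by positivity)]
    have h3' := mul_le_mul_of_nonneg_right h1 (show (0 : ℝ) ≤ 16 * β by positivity)
    have e : Real.exp (-(β ^ ((3 : ℝ) / 20))) / f * (16 * β) = 16 / f * β * Real.exp (-(β ^ ((3 : ℝ) / 20))) := by
      field_simp
    generalize Real.exp (-(β ^ ((3 : ℝ) / 20))) = X at h3' e h5 ⊢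
    linarith [h3', e, h5]
  rw [hs] at hq1 hq2 hq3 hA1 hA0
  exact ⟨hq1, hq2, hq3, hA1, hA0, hcb', hk', ht'⟩

end VacuumConc

end Summit.QuantumFields.YangMills.Theorems.TransportFieldFano

end
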